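import Summits.CriticalPhenomena.PercolationContinuityZ3.Theorems.PercNearOneGluingNoHeavyLowerTailAttachedChampionLevelOneTools
import Summits.CriticalPhenomena.PercolationContinuityZ3.Theorems.PercNearOneGluingNoHeavyLowerTailGuardedLonelyRelay
import HarnessLib

/-!
# `NoHeavyLowerTail` (stmt-CriticalPhenomena-4575) — the attached-champion inequality at level `|A| − 2`: the chain

Lead of the crux, 2026-08-18.  `μ = prodBernoulli w` on `Fin n`, relays `A` (`k = |A| ≥ 3`), observer `o`, level
`j = k − 2`; `D_d = {d ↮ A∖d}`, `Q_d = {A∖d pairwise joined}` (so `D_d ∩ Q_d = {the relay partition is (A∖d | d)}`,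
`h(d) := μ(D_d ∩ Q_d)`), `Sep = {A pairwise separated}`, `U = ⋃_{b ∈ A∖q} {o ↔ b}`.

At level `k − 2` the event `{1 ≤ N ≤ k−2} ∖ {|π(q)| ≤ k−2}` is covered by `⋃_{d ≠ q} ({o↔d} ∩ D_d ∩ Q_d)` and
`U ∩ D_q ∩ Q_q ⊆ {|π(q)| ≤ k−2} ∩ {o ↔ A} ∖ {1 ≤ N ≤ k−2}`, so the attached-champion inequality (registered stub
`stub_attachedChampion`) at level `k − 2` follows from the chain proved here (`chain_of_pairSep_pos`):

  `Σ_{d ≠ q} μ({o↔d} ∩ D_d ∩ Q_d) ≤ μ(U ∩ D_q ∩ Q_q) + δ`   whenever `h(d) ≤ h(q) + δ` for all `d` and `μ(Sep) > 0`,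

by: KN Lemma 1(ii) (`GuardedLonelyRelay.negCorr`) and Lemma 1(i) (`GuardedLonelyRelay.termSep`) for each `d`;
disjointness of `{o ↔ d} ∩ Sep`; the set-BHK steps `AttachedChampionLevelOne.sep_touch_negCorr` (negative correlation of
`U` and pairwise separation of `A∖q` given `D_q`) and `AttachedChampionLevelOne.setCluster_upper_upper` (positive
correlation of `U` and `Q_q` given `D_q`).  The sequel file removes `μ(Sep) > 0` and identifies the events.
-/

noncomputable section

namespace Summit.CriticalPhenomena.PercolationContinuityZ3.Theorems

open MeasureTheory Set Filter Literature.Probability.LatticeModels Literature.Probability.Percolation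
open scoped Classical BigOperators Topology

namespace AttachedChampionCardSubTwo

variable {n : ℕ}

/-- **Positive correlation of `{o ↔ A∖q}` and `{A∖q pairwise joined}` given `{q ↮ A∖q}`** (set-BHK, two
increasing events of the cluster `C_{A∖q}`):
`μ(D_q ∩ U) · μ(D_q ∩ Q_q) ≤ μ(D_q) · μ(D_q ∩ (U ∩ Q_q))`.
[cite: VandenbergHaggstromKahn2005, Thm. 1.3 with Remark 1 (p. 5)] -/
theorem touch_connAll_posCorr (w : Sym2 (Fin n) → unitInterval) (S : Finset (Fin n)) (q o : Fin n) :
    (prodBernoulli w).real ({ω : BondConfig (Fin n) | ∀ t ∈ S, ω ∉ openConn q t} ∩ ⋃ b ∈ S, openConn o b) *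
      (prodBernoulli w).real ({ω : BondConfig (Fin n) | ∀ t ∈ S, ω ∉ openConn q t} ∩
        {ω | ∀ t ∈ S, ∀ t' ∈ S, ω ∈ openConn t t'}) ≤
    (prodBernoulli w).real {ω : BondConfig (Fin n) | ∀ t ∈ S, ω ∉ openConn q t} *
      (prodBernoulli w).real ({ω : BondConfig (Fin n) | ∀ t ∈ S, ω ∉ openConn q t} ∩
        ((⋃ b ∈ S, openConn o b) ∩ {ω | ∀ t ∈ S, ∀ t' ∈ S, ω ∈ openConn t t'})) := by
  set μ := prodBernoulli w with hμ
  set D : Set (BondConfig (Fin n)) := {ω | ∀ t ∈ S, ω ∉ openConn q t} with hD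
  have hDeq : {ω : BondConfig (Fin n) | ∀ s ∈ (↑S : Set (Fin n)), ∀ t ∈ ({q} : Set (Fin n)),
      ¬ (openGraph ω).Reachable s t} = D := by
    ext ω
    simp only [Set.mem_setOf_eq, Finset.mem_coe, Set.mem_singleton_iff, forall_eq, hD]
    refine forall₂_congr fun t ht => ?_
    change ¬ (openGraph ω).Reachable t q ↔ ¬ (openGraph ω).Reachable q t
    rw [SimpleGraph.reachable_comm]
  set U : Set (BondConfig (Fin n)) := ⋃ b ∈ S, openConn o b with hU
  set Q : Set (BondConfig (Fin n)) := {ω | ∀ t ∈ S, ∀ t' ∈ S, ω ∈ openConn t t'} with hQ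
  have hUeq : {ω : BondConfig (Fin n) | o ∈ (↑S : Set (Fin n)) ∨
      ∃ e ∈ ⋃ s ∈ (↑S : Set (Fin n)), openEdgeCluster ω s, o ∈ e} = U := by
    rw [TwoSetConditionalAssociation.setOf_mem_or_exists_mem_biUnion_openEdgeCluster]
    rw [hU]
    ext ω
    simp only [Set.mem_iUnion, Finset.mem_coe, exists_prop]
    refine exists_congr fun b => and_congr_right fun _ => ?_
    rw [KNPreFKG.openConn_symm]
  have hQeq : {ω : BondConfig (Fin n) | ∀ t ∈ (↑S : Set (Fin n)), ∀ t' ∈ (↑S : Set (Fin n)),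
      (SimpleGraph.fromEdgeSet (⋃ x ∈ (↑S : Set (Fin n)), openEdgeCluster ω x)).Reachable t t'} = Q := by
    ext ω
    have h := GuardedLonelyRelay.connAllFn_biUnion_openEdgeCluster (↑S : Set (Fin n)) ω
    simp only [Set.mem_setOf_eq, hQ, Finset.mem_coe]
    by_cases hq : ∀ t ∈ (↑S : Set (Fin n)), ∀ t' ∈ (↑S : Set (Fin n)),
        (SimpleGraph.fromEdgeSet (⋃ s ∈ (↑S : Set (Fin n)), openEdgeCluster ω s)).Reachable t t'
    · rw [if_pos hq] at h
      have hmem : ω ∈ {ω' : BondConfig (Fin n) | ∀ t ∈ (↑S : Set (Fin n)), ∀ t' ∈ (↑S : Set (Fin n)),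
          ω' ∈ openConn t t'} := by
        by_contra hnot
        rw [Set.indicator_of_notMem hnot] at h
        exact one_ne_zero h
      simp only [Set.mem_setOf_eq, Finset.mem_coe] at hmem
      exact ⟨fun _ => hmem, fun _ => hq⟩
    · rw [if_neg hq] at h
      have hnot : ω ∉ {ω' : BondConfig (Fin n) | ∀ t ∈ (↑S : Set (Fin n)), ∀ t' ∈ (↑S : Set (Fin n)),
          ω' ∈ openConn t t'} := by
        intro hmem
        rw [Set.indicator_of_mem hmem, Pi.one_apply] at h
        exact zero_ne_one h
      simp only [Set.mem_setOf_eq, Finset.mem_coe] at hnot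
      exact ⟨fun h' => absurd h' hq, fun h' => absurd h' hnot⟩
  have key := AttachedChampionLevelOne.setCluster_upper_upper w (↑S : Set (Fin n)) ({q} : Set (Fin n))
    (fun C => o ∈ (↑S : Set (Fin n)) ∨ ∃ e ∈ C, o ∈ e)
    (fun C => ∀ t ∈ (↑S : Set (Fin n)), ∀ t' ∈ (↑S : Set (Fin n)), (SimpleGraph.fromEdgeSet C).Reachable t t')
    (AttachedChampionLevelOne.touch_mono _ o)
    (fun C C' hCC' h t ht t' ht' => (h t ht t' ht').mono (SimpleGraph.fromEdgeSet_mono hCC'))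
  rw [hDeq] at key
  change μ.real (D ∩ {ω | o ∈ (↑S : Set (Fin n)) ∨ ∃ e ∈ ⋃ s ∈ (↑S : Set (Fin n)), openEdgeCluster ω s, o ∈ e}) *
      μ.real (D ∩ {ω | ∀ t ∈ (↑S : Set (Fin n)), ∀ t' ∈ (↑S : Set (Fin n)),
        (SimpleGraph.fromEdgeSet (⋃ x ∈ (↑S : Set (Fin n)), openEdgeCluster ω x)).Reachable t t'}) ≤
    μ.real D * μ.real (D ∩ ({ω | o ∈ (↑S : Set (Fin n)) ∨
        ∃ e ∈ ⋃ s ∈ (↑S : Set (Fin n)), openEdgeCluster ω s, o ∈ e} ∩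
      {ω | ∀ t ∈ (↑S : Set (Fin n)), ∀ t' ∈ (↑S : Set (Fin n)),
        (SimpleGraph.fromEdgeSet (⋃ x ∈ (↑S : Set (Fin n)), openEdgeCluster ω x)).Reachable t t'})) at key
  rw [hUeq, hQeq] at key
  exact key

/-- **The level-`|A|−2` chain with a non-null separation event (deficiency form).**  With
`D_d = {d ↮ A∖d}`, `Q_d = {A∖d pairwise joined}`, `h(d) = μ(D_d ∩ Q_d)`, `Sep = {A pairwise separated}`,
`U = ⋃_{b ∈ A∖q} {o ↔ b}`: if `h(d) ≤ h(q) + δ` for all `d ∈ A` and `μ(Sep) > 0`, then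
`Σ_{d ∈ A∖q} μ({o↔d} ∩ D_d ∩ Q_d) ≤ μ(D_q ∩ (U ∩ Q_q)) + δ`.
[cite: KozmaNitzan2024, Lemmas 1–2 (pp. 5–6); VandenbergHaggstromKahn2005, Thms. 1.3, 1.5] -/
theorem chain_of_pairSep_pos (w : Sym2 (Fin n) → unitInterval) (A : Finset (Fin n)) (o q : Fin n) (δ : ℝ)
    (hδ : 0 ≤ δ) (hq : q ∈ A)
    (hcmp : ∀ d ∈ A,
      (prodBernoulli w).real ({ω : BondConfig (Fin n) | ∀ t ∈ A.erase d, ω ∉ openConn d t} ∩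
          {ω | ∀ t ∈ (↑(A.erase d) : Set (Fin n)), ∀ t' ∈ (↑(A.erase d) : Set (Fin n)), ω ∈ openConn t t'}) ≤
        (prodBernoulli w).real ({ω : BondConfig (Fin n) | ∀ t ∈ A.erase q, ω ∉ openConn q t} ∩
          {ω | ∀ t ∈ (↑(A.erase q) : Set (Fin n)), ∀ t' ∈ (↑(A.erase q) : Set (Fin n)), ω ∈ openConn t t'}) + δ)
    (hM : 0 < (prodBernoulli w).real
      {ω : Set (Sym2 (Fin n)) | ∀ x ∈ A, ∀ y ∈ A, x ≠ y → ω ∉ openConn x y}) :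
    ∑ d ∈ A.erase q, (prodBernoulli w).real
        (openConn o d ∩ {ω : BondConfig (Fin n) | ∀ t ∈ A.erase d, ω ∉ openConn d t} ∩
          {ω | ∀ t ∈ (↑(A.erase d) : Set (Fin n)), ∀ t' ∈ (↑(A.erase d) : Set (Fin n)), ω ∈ openConn t t'}) ≤
      (prodBernoulli w).real ({ω : BondConfig (Fin n) | ∀ t ∈ A.erase q, ω ∉ openConn q t} ∩
        ((⋃ b ∈ A.erase q, openConn o b) ∩ {ω | ∀ t ∈ (↑(A.erase q) : Set (Fin n)), ∀ t' ∈ (↑(A.erase q) : Set (Fin n)), ω ∈ openConn t t'})) + δ := by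
  set μ := prodBernoulli w with hμ
  set Sep : Set (BondConfig (Fin n)) := {ω | ∀ x ∈ A, ∀ y ∈ A, x ≠ y → ω ∉ openConn x y} with hSep
  set D : Fin n → Set (BondConfig (Fin n)) := fun d => {ω | ∀ t ∈ A.erase d, ω ∉ openConn d t} with hD
  set Qc : Fin n → Set (BondConfig (Fin n)) :=
    fun d => {ω | ∀ t ∈ (↑(A.erase d) : Set (Fin n)), ∀ t' ∈ (↑(A.erase d) : Set (Fin n)), ω ∈ openConn t t'} with hQc
  set U : Set (BondConfig (Fin n)) := ⋃ b ∈ A.erase q, openConn o b with hU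
  have hmeas : ∀ s : Set (BondConfig (Fin n)), MeasurableSet s := fun _ => MeasurableSet.of_discrete
  have hnn : ∀ s : Set (BondConfig (Fin n)), 0 ≤ μ.real s := fun _ => measureReal_nonneg
  -- (1) per relay `d ≠ q`: `T_d · μ(Sep) ≤ h(d) · μ({o↔d} ∩ Sep)`
  have h1 : ∀ d ∈ A.erase q,
      μ.real (openConn o d ∩ D d ∩ Qc d) * μ.real Sep ≤ μ.real (D d ∩ Qc d) * μ.real (openConn o d ∩ Sep) := by
    intro d hd
    have hdA : d ∈ A := Finset.mem_of_mem_erase hd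
    -- KN Lemma 1(ii): `μ(D_d) μ({o↔d} ∩ D_d ∩ Q_d) ≤ μ({o↔d} ∩ D_d) μ(D_d ∩ Q_d)`
    have hneg : μ.real (D d) * μ.real (openConn o d ∩ D d ∩ Qc d) ≤
        μ.real (openConn o d ∩ D d) * μ.real (D d ∩ Qc d) := by
      exact GuardedLonelyRelay.negCorr w A o d (Qc d) _
        (GuardedLonelyRelay.connAllFn_monotone (↑(A.erase d) : Set (Fin n)))
        (GuardedLonelyRelay.connAllFn_biUnion_openEdgeCluster _)
    -- KN Lemma 1(i): `μ({o↔d} ∩ D_d) μ(Sep) ≤ μ(D_d) μ({o↔d} ∩ Sep)`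
    have hts : μ.real (openConn o d ∩ D d) * μ.real Sep ≤ μ.real (D d) * μ.real (openConn o d ∩ Sep) :=
      GuardedLonelyRelay.termSep w A o hdA
    by_cases hDz : μ.real (D d) = 0
    · have hT : μ.real (openConn o d ∩ D d ∩ Qc d) = 0 :=
        le_antisymm (hDz ▸ measureReal_mono (fun ω hω => hω.1.2) (measure_ne_top μ _)) (hnn _)
      rw [hT, zero_mul]
      exact mul_nonneg (hnn _) (hnn _)
    · have hDpos : 0 < μ.real (D d) := lt_of_le_of_ne (hnn _) (Ne.symm hDz)
      have key : μ.real (D d) * (μ.real (openConn o d ∩ D d ∩ Qc d) * μ.real Sep) ≤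
          μ.real (D d) * (μ.real (D d ∩ Qc d) * μ.real (openConn o d ∩ Sep)) := by
        calc μ.real (D d) * (μ.real (openConn o d ∩ D d ∩ Qc d) * μ.real Sep)
            = (μ.real (D d) * μ.real (openConn o d ∩ D d ∩ Qc d)) * μ.real Sep := by ring
          _ ≤ (μ.real (openConn o d ∩ D d) * μ.real (D d ∩ Qc d)) * μ.real Sep :=
              mul_le_mul_of_nonneg_right hneg (hnn _)
          _ = μ.real (D d ∩ Qc d) * (μ.real (openConn o d ∩ D d) * μ.real Sep) := by ring
          _ ≤ μ.real (D d ∩ Qc d) * (μ.real (D d) * μ.real (openConn o d ∩ Sep)) :=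
              mul_le_mul_of_nonneg_left hts (hnn _)
          _ = μ.real (D d) * (μ.real (D d ∩ Qc d) * μ.real (openConn o d ∩ Sep)) := by ring
      exact le_of_mul_le_mul_left key hDpos
  -- (2) sum over `d ≠ q`, use the deficient champion and disjointness of `{o↔d} ∩ Sep`
  have hU_sum : ∑ d ∈ A.erase q, μ.real (openConn o d ∩ Sep) = μ.real (U ∩ Sep) := by
    rw [hU, Set.iUnion₂_inter]
    exact (measureReal_biUnion_finset
      (singleFinger_pairwiseDisjoint_conn_inter_pairSep A (A.erase q) o (Finset.erase_subset q A))
      (fun b _ => hmeas _)).symm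
  have h2 : (∑ d ∈ A.erase q, μ.real (openConn o d ∩ D d ∩ Qc d)) * μ.real Sep ≤
      μ.real (D q ∩ Qc q) * μ.real (U ∩ Sep) + δ * μ.real Sep := by
    rw [Finset.sum_mul]
    calc ∑ d ∈ A.erase q, μ.real (openConn o d ∩ D d ∩ Qc d) * μ.real Sep
        ≤ ∑ d ∈ A.erase q, (μ.real (D q ∩ Qc q) + δ) * μ.real (openConn o d ∩ Sep) :=
          Finset.sum_le_sum fun d hd => (h1 d hd).trans
            (mul_le_mul_of_nonneg_right (hcmp d (Finset.mem_of_mem_erase hd)) (hnn _))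
      _ = (μ.real (D q ∩ Qc q) + δ) * μ.real (U ∩ Sep) := by rw [← Finset.mul_sum, hU_sum]
      _ = μ.real (D q ∩ Qc q) * μ.real (U ∩ Sep) + δ * μ.real (U ∩ Sep) := by ring
      _ ≤ μ.real (D q ∩ Qc q) * μ.real (U ∩ Sep) + δ * μ.real Sep := by
          have : μ.real (U ∩ Sep) ≤ μ.real Sep := measureReal_mono Set.inter_subset_right (measure_ne_top μ _)
          nlinarith
  -- (3) the two set-BHK steps at `q`: `h(q) μ(U ∩ Sep) ≤ μ(D_q ∩ (U ∩ Q_q)) μ(Sep)`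
  have hSepEq : D q ∩ {ω : BondConfig (Fin n) | ∀ t ∈ A.erase q, ∀ t' ∈ A.erase q, t ≠ t' → ω ∉ openConn t t'}
      = Sep := by
    rw [hD, hSep]; exact singleFinger_sep_inter_pairSep_eq A hq
  have h4 : μ.real (D q) * μ.real (U ∩ Sep) ≤ μ.real (D q ∩ U) * μ.real Sep := by
    have key := AttachedChampionLevelOne.sep_touch_negCorr w (A.erase q) q o
    have hUS : D q ∩ (U ∩ {ω : BondConfig (Fin n) | ∀ t ∈ A.erase q, ∀ t' ∈ A.erase q, t ≠ t' →
        ω ∉ openConn t t'}) = U ∩ Sep := by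
      rw [← hSepEq, ← Set.inter_assoc, Set.inter_comm (D q) U, Set.inter_assoc]
    rw [hUS, hSepEq] at key
    exact key
  have h5 : μ.real (D q ∩ U) * μ.real (D q ∩ Qc q) ≤ μ.real (D q) * μ.real (D q ∩ (U ∩ Qc q)) := by
    have hQ : Qc q = {ω : BondConfig (Fin n) | ∀ t ∈ A.erase q, ∀ t' ∈ A.erase q, ω ∈ openConn t t'} := rfl
    rw [hQ]
    exact touch_connAll_posCorr w (A.erase q) q o
  have h3 : μ.real (D q ∩ Qc q) * μ.real (U ∩ Sep) ≤ μ.real (D q ∩ (U ∩ Qc q)) * μ.real Sep := by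
    by_cases hDz : μ.real (D q) = 0
    · have hh : μ.real (D q ∩ Qc q) = 0 :=
        le_antisymm (hDz ▸ measureReal_mono Set.inter_subset_left (measure_ne_top μ _)) (hnn _)
      rw [hh, zero_mul]
      exact mul_nonneg (hnn _) (hnn _)
    · have hDpos : 0 < μ.real (D q) := lt_of_le_of_ne (hnn _) (Ne.symm hDz)
      have key : μ.real (D q) * (μ.real (D q ∩ Qc q) * μ.real (U ∩ Sep)) ≤
          μ.real (D q) * (μ.real (D q ∩ (U ∩ Qc q)) * μ.real Sep) := by
        calc μ.real (D q) * (μ.real (D q ∩ Qc q) * μ.real (U ∩ Sep))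
            = μ.real (D q ∩ Qc q) * (μ.real (D q) * μ.real (U ∩ Sep)) := by ring
          _ ≤ μ.real (D q ∩ Qc q) * (μ.real (D q ∩ U) * μ.real Sep) :=
              mul_le_mul_of_nonneg_left h4 (hnn _)
          _ = (μ.real (D q ∩ U) * μ.real (D q ∩ Qc q)) * μ.real Sep := by ring
          _ ≤ (μ.real (D q) * μ.real (D q ∩ (U ∩ Qc q))) * μ.real Sep :=
              mul_le_mul_of_nonneg_right h5 (hnn _)
          _ = μ.real (D q) * (μ.real (D q ∩ (U ∩ Qc q)) * μ.real Sep) := by ring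
      exact le_of_mul_le_mul_left key hDpos
  -- (4) divide by `μ(Sep) > 0`
  have hfin : (∑ d ∈ A.erase q, μ.real (openConn o d ∩ D d ∩ Qc d)) * μ.real Sep ≤
      (μ.real (D q ∩ (U ∩ Qc q)) + δ) * μ.real Sep := by nlinarith [h2, h3]
  exact le_of_mul_le_mul_right hfin hM

end AttachedChampionCardSubTwo

end Summit.CriticalPhenomena.PercolationContinuityZ3.Theorems

end
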